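import Summits.ValiantsHypothesis.ValiantsHypothesis.Theorems.LacunarySymmetroidMatrixDescartesPivotRankOneCriticalWindowsTurningEnds

/-!
# `MatrixDescartes` census — rank-one `(2,4)₁`, the e-free exponent profile: END VALUES ON THE `3|1` SPLIT (mirror of `…TurningEnds`)
# (`E < e` near `0⁺` and near `∞` when THREE letters lie below the pivot)

HONEST FRAMING.  Object-search cell `pub-symmetroid`, seat `val-sym-mdr-p1` (generation 27); helper file `--supports` the crux item
stmt-ValiantsHypothesis-18050 (`Theses.LacunarySymmetroid.MatrixDescartes`, OPEN, on HOLD) with NO closure claim.  Companion of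
`…CriticalWindowsTurningEnds` (the `1|3` split, `E > e` at both ends) for the mirror chamber: on the `3|1` split of the `(2,4)₁` cell
(`d₀ < d₁ ≤ d₂ < e < d₃`, all-core rank-one letters, `0∦1`, `2∦3`) the SIGNED DENT SUM `∑ (dₖ − e)Wₖ(T̂ − tₖ)²` is NEGATIVE for all small
`x > 0` (`signedDent_neg_near_zero`: letter `1`'s negative dent beats the top letter's, which carries the weight `x^{d₃}`) and for all large `x`
(`signedDent_neg_near_infty`: letter `2`'s negative dent `≥ |t₂−t₃|²/4` at weight `x^{d₂}` beats the top letter's dent `O(x^{2(d₂−d₃)})` at weight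
`x^{d₃}`, because `T̂ → t₃` at rate `x^{d₂−d₃}`), hence `E(x) < e` at both ends (`profile_lt_near_zero`, `profile_lt_near_infty`; located values
`E(0⁺) = d₁`, `E(∞) = d₂`).  By `x ↦ 1/x` this is the `1|3` file read backwards (`E♭(x) = N − E(1/x)` for the reversed exponents); it is typed
directly so that the parity count applies to chamber (C′) in its own coordinates.  Nothing here bears on `MatrixDescartes` in its window, on
`DoorA26` / `DoorA34`, registers / credences, or `VP ≠ VNP`.

[folklore] Elementary real inequalities; tree `…TurningEnds.dev_bound` / `abs_sub_mul_le` / `quarter_sq_le` / `profile_num_sub`,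
`…Turning.optDir_pos_sq` / `dent_pos`.  No definitions, no named facts.
-/

-- `Summit.ValiantsHypothesis.ValiantsHypothesis.…` repeats a component by the D-0017 layout
-- (single-conjunct summit), which the `dupNamespace` linter flags; the name is mandated.
set_option linter.dupNamespace false

namespace Summit.ValiantsHypothesis.ValiantsHypothesis.Theorems.LacunarySymmetroidMatrixDescartes.Pivot.CriticalWindows.TurningEndsMirror

open Finset
open scoped BigOperators
open Summit.ValiantsHypothesis.ValiantsHypothesis.Theorems.LacunarySymmetroidMatrixDescartes.Pivot.CriticalWindows.Turning
  (optDir_pos_sq dent_pos)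
open Summit.ValiantsHypothesis.ValiantsHypothesis.Theorems.LacunarySymmetroidMatrixDescartes.Pivot.CriticalWindows.TurningEnds
  (dev_bound abs_sub_mul_le quarter_sq_le profile_num_sub)

/-! ## 1. Near `0⁺`: the negative dent of letter `1` wins -/

/-- **SIGNED DENT SUM NEGATIVE NEAR `0⁺` (`3|1`).**  Four letters with positive weights and positions, exponents `d₀ < d₁ ≤ d₂ ≤ e < d₃`,
`d₁ < e`, letters `0, 1` not parallel.  There is `a > 0` such that for every `0 < x ≤ a` and every direction `τ > 0` with `A τ² = C`:
`∑ₖ (dₖ − e)·wₖx^{dₖ}·(τ − tₖ)² < 0` — letters `0, 1, 2` contribute `≤ 0`, letter `1` at least `(e − d₁)w₁x^{d₁}|t₀−t₁|²/4`, and the only positive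
term (letter `3`) is `O(x^{d₃})`. [this file] -/
theorem signedDent_neg_near_zero (w t : Fin 4 → ℝ) (d : Fin 4 → ℕ) (e : ℕ)
    (hw : ∀ k, 0 < w k) (ht : ∀ k, 0 < t k) (h01 : t 0 ≠ t 1)
    (h01d : d 0 < d 1) (h12 : d 1 ≤ d 2) (h2e : d 2 ≤ e) (h1e : d 1 < e) (he3 : e < d 3) :
    ∃ a, 0 < a ∧ ∀ x, 0 < x → x ≤ a → ∀ τ, 0 < τ →
      (∑ k, w k * x ^ d k) * τ ^ 2 = ∑ k, w k * t k ^ 2 * x ^ d k →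
      ∑ k, ((d k : ℝ) - e) * (w k * x ^ d k) * (τ - t k) ^ 2 < 0 := by
  have hw0 := hw 0; have hw1 := hw 1; have hw2 := hw 2; have hw3 := hw 3
  have ht0 := ht 0; have ht1 := ht 1
  set M : ℝ := w 1 * |t 1 ^ 2 - t 0 ^ 2| + w 2 * |t 2 ^ 2 - t 0 ^ 2| + w 3 * |t 3 ^ 2 - t 0 ^ 2| with hM
  set D : ℝ := |t 0 - t 1| with hD
  have hDpos : 0 < D := abs_pos.2 (sub_ne_zero.2 h01)
  have hsq01 : t 1 ^ 2 - t 0 ^ 2 ≠ 0 := by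
    rw [sq_sub_sq]; exact mul_ne_zero (by linarith) (sub_ne_zero.2 (Ne.symm h01))
  have hMpos : 0 < M := by
    have h1 : 0 < w 1 * |t 1 ^ 2 - t 0 ^ 2| := mul_pos hw1 (abs_pos.2 hsq01)
    have h2 : 0 ≤ w 2 * |t 2 ^ 2 - t 0 ^ 2| := by positivity
    have h3 : 0 ≤ w 3 * |t 3 ^ 2 - t 0 ^ 2| := by positivity
    linarith
  set Θ : ℝ := 2 * (t 0 ^ 2 + t 1 ^ 2 + t 2 ^ 2 + t 3 ^ 2) + 2 * t 3 ^ 2 with hΘ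
  have hΘpos : 0 < Θ := by positivity
  have hed1 : (0 : ℝ) < (e : ℝ) - d 1 := sub_pos.2 (by exact_mod_cast h1e)
  have hd3e : (0 : ℝ) < (d 3 : ℝ) - e := sub_pos.2 (by exact_mod_cast he3)
  set κ : ℝ := ((e : ℝ) - d 1) * w 1 * D ^ 2 / (4 * ((d 3 : ℝ) - e) * w 3 * Θ) with hκ
  have hκpos : 0 < κ := by rw [hκ]; positivity
  set a : ℝ := min 1 (min (D * t 0 * w 0 / (2 * M)) (κ / 2)) with ha
  have ha1 : a ≤ 1 := min_le_left _ _
  have ha2 : a ≤ D * t 0 * w 0 / (2 * M) := le_trans (min_le_right _ _) (min_le_left _ _)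
  have ha3 : a ≤ κ / 2 := le_trans (min_le_right _ _) (min_le_right _ _)
  refine ⟨a, by rw [ha]; positivity, ?_⟩
  intro x hx hxa τ hτ hAC
  have hx1 : x ≤ 1 := hxa.trans ha1
  set P := x ^ d 0 with hP
  set Q := x ^ d 1 with hQ
  set S := x ^ d 3 with hS
  have hPpos : 0 < P := pow_pos hx _
  have hQpos : 0 < Q := pow_pos hx _
  have hSpos : 0 < S := pow_pos hx _
  have hQ2 : x ^ d 2 ≤ Q := pow_le_pow_of_le_one hx.le hx1 h12
  have hQ3 : S ≤ Q := pow_le_pow_of_le_one hx.le hx1 (by omega)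
  have hQP : Q ≤ x * P := by
    have h : x ^ d 1 ≤ x ^ (d 0 + 1) := pow_le_pow_of_le_one hx.le hx1 (by omega)
    rw [pow_succ] at h
    rw [hQ, hP]; linarith
  have hSQ : S ≤ x * Q := by
    have h : x ^ d 3 ≤ x ^ (d 1 + 1) := pow_le_pow_of_le_one hx.le hx1 (by omega)
    rw [pow_succ] at h
    rw [hS, hQ]; linarith
  simp only [Fin.sum_univ_four] at hAC ⊢
  rw [← hP, ← hQ, ← hS] at hAC ⊢
  -- deviation of `τ` from `t₀`: `|τ − t₀|·(w₀ P t₀) ≤ Q·M`, hence `|τ − t₀| ≤ D/2`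
  have hA_ge : w 0 * P ≤ w 0 * P + w 1 * Q + w 2 * x ^ d 2 + w 3 * S := by
    have : 0 ≤ w 1 * Q := by positivity
    have : 0 ≤ w 2 * x ^ d 2 := by positivity
    have : 0 ≤ w 3 * S := by positivity
    linarith
  have hdevb := dev_bound (w 0 * P) (w 1 * Q) (w 2 * x ^ d 2) (w 3 * S) (t 0) (t 1) (t 2) (t 3) τ
    (by positivity) (by positivity) (by positivity) (by positivity) (by linear_combination hAC)
  have hRM : w 1 * Q * |t 1 ^ 2 - t 0 ^ 2| + w 2 * x ^ d 2 * |t 2 ^ 2 - t 0 ^ 2| + w 3 * S * |t 3 ^ 2 - t 0 ^ 2| ≤ Q * M := by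
    have a2 : w 2 * x ^ d 2 * |t 2 ^ 2 - t 0 ^ 2| ≤ w 2 * Q * |t 2 ^ 2 - t 0 ^ 2| :=
      mul_le_mul_of_nonneg_right (mul_le_mul_of_nonneg_left hQ2 hw2.le) (abs_nonneg _)
    have a3 : w 3 * S * |t 3 ^ 2 - t 0 ^ 2| ≤ w 3 * Q * |t 3 ^ 2 - t 0 ^ 2| :=
      mul_le_mul_of_nonneg_right (mul_le_mul_of_nonneg_left hQ3 hw3.le) (abs_nonneg _)
    have e : w 1 * Q * |t 1 ^ 2 - t 0 ^ 2| + w 2 * Q * |t 2 ^ 2 - t 0 ^ 2| + w 3 * Q * |t 3 ^ 2 - t 0 ^ 2| = Q * M := by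
      rw [hM]; ring
    linarith
  have hkey : |τ - t 0| * (w 0 * P * t 0) ≤ Q * M := by
    have h2 : |τ ^ 2 - t 0 ^ 2| * (w 0 * P) ≤ Q * M := by
      have := mul_le_mul_of_nonneg_left hA_ge (abs_nonneg (τ ^ 2 - t 0 ^ 2))
      linarith
    calc |τ - t 0| * (w 0 * P * t 0) = (|τ - t 0| * t 0) * (w 0 * P) := by ring
      _ ≤ |τ ^ 2 - t 0 ^ 2| * (w 0 * P) := mul_le_mul_of_nonneg_right (abs_sub_mul_le τ (t 0) hτ ht0) (by positivity)
      _ ≤ Q * M := h2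
  have hxa2 : 2 * M * x ≤ D * t 0 * w 0 := by
    have := (le_div_iff₀ (by positivity : (0 : ℝ) < 2 * M)).1 (hxa.trans ha2)
    linarith
  have hdev0 : |τ - t 0| ≤ |t 0 - t 1| / 2 := by
    have h : |τ - t 0| * (w 0 * P * t 0) ≤ (D / 2) * (w 0 * P * t 0) := by
      calc |τ - t 0| * (w 0 * P * t 0) ≤ Q * M := hkey
        _ ≤ x * P * M := mul_le_mul_of_nonneg_right hQP hMpos.le
        _ = (2 * M * x) * P / 2 := by ring
        _ ≤ (D * t 0 * w 0) * P / 2 := by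
            have := mul_le_mul_of_nonneg_right hxa2 hPpos.le
            linarith
        _ = (D / 2) * (w 0 * P * t 0) := by ring
    exact le_of_mul_le_mul_right h (by positivity)
  have hdent1 : D ^ 2 / 4 ≤ (τ - t 1) ^ 2 := by
    have h := quarter_sq_le τ (t 0) (t 1) hdev0
    rwa [← sq_abs (t 0 - t 1), ← hD] at h
  -- the only positive term (letter 3) is at most `(d₃ − e)·w₃·Θ·S`: `τ² ≤ Σ tₖ²`
  have hτsq : τ ^ 2 ≤ t 0 ^ 2 + t 1 ^ 2 + t 2 ^ 2 + t 3 ^ 2 := by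
    have p0 : 0 ≤ w 0 * P := by positivity
    have p1 : 0 ≤ w 1 * Q := by positivity
    have p2 : 0 ≤ w 2 * x ^ d 2 := by positivity
    have p3 : 0 ≤ w 3 * S := by positivity
    have q0 := mul_nonneg p0 (add_nonneg (add_nonneg (sq_nonneg (t 1)) (sq_nonneg (t 2))) (sq_nonneg (t 3)))
    have q1 := mul_nonneg p1 (add_nonneg (add_nonneg (sq_nonneg (t 0)) (sq_nonneg (t 2))) (sq_nonneg (t 3)))
    have q2 := mul_nonneg p2 (add_nonneg (add_nonneg (sq_nonneg (t 0)) (sq_nonneg (t 1))) (sq_nonneg (t 3)))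
    have q3 := mul_nonneg p3 (add_nonneg (add_nonneg (sq_nonneg (t 0)) (sq_nonneg (t 1))) (sq_nonneg (t 2)))
    have hA0 : 0 < w 0 * P + w 1 * Q + w 2 * x ^ d 2 + w 3 * S := by positivity
    by_contra hlt
    push Not at hlt
    have h1 := mul_lt_mul_of_pos_right hlt hA0
    have key : (t 0 ^ 2 + t 1 ^ 2 + t 2 ^ 2 + t 3 ^ 2) * (w 0 * P + w 1 * Q + w 2 * x ^ d 2 + w 3 * S)
        = (w 0 * P + w 1 * Q + w 2 * x ^ d 2 + w 3 * S) * τ ^ 2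
          + (w 0 * P * (t 1 ^ 2 + t 2 ^ 2 + t 3 ^ 2) + w 1 * Q * (t 0 ^ 2 + t 2 ^ 2 + t 3 ^ 2)
          + w 2 * x ^ d 2 * (t 0 ^ 2 + t 1 ^ 2 + t 3 ^ 2) + w 3 * S * (t 0 ^ 2 + t 1 ^ 2 + t 2 ^ 2)) := by
      rw [hAC]; ring
    linarith [key, q0, q1, q2, q3, h1]
  have hpos0 : (τ - t 3) ^ 2 ≤ Θ := by
    have hsq : (τ - t 3) ^ 2 = 2 * τ ^ 2 + 2 * t 3 ^ 2 - (τ + t 3) ^ 2 := by ring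
    rw [hΘ, hsq]; linarith [sq_nonneg (τ + t 3), hτsq, sq_nonneg (t 0), sq_nonneg (t 1), sq_nonneg (t 2)]
  have hpos3 : ((d 3 : ℝ) - e) * (w 3 * S) * (τ - t 3) ^ 2 ≤ ((d 3 : ℝ) - e) * w 3 * Θ * S := by
    have := mul_le_mul_of_nonneg_left hpos0 (by positivity : (0 : ℝ) ≤ ((d 3 : ℝ) - e) * (w 3 * S))
    linarith [this]
  -- letter 1's negative dent and the threshold `x < κ`
  have hneg1 : ((e : ℝ) - d 1) * (w 1 * Q) * (D ^ 2 / 4) ≤ ((e : ℝ) - d 1) * (w 1 * Q) * (τ - t 1) ^ 2 :=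
    mul_le_mul_of_nonneg_left hdent1 (by positivity)
  have hxκ : x * (4 * ((d 3 : ℝ) - e) * w 3 * Θ) < ((e : ℝ) - d 1) * w 1 * D ^ 2 := by
    have hlt : x < κ := lt_of_le_of_lt (hxa.trans ha3) (by linarith)
    rw [hκ, lt_div_iff₀ (by positivity)] at hlt
    exact hlt
  have hmain : ((d 3 : ℝ) - e) * (w 3 * S) * (τ - t 3) ^ 2 < ((e : ℝ) - d 1) * (w 1 * Q) * (τ - t 1) ^ 2 := by
    have step : ((d 3 : ℝ) - e) * w 3 * Θ * S < ((e : ℝ) - d 1) * (w 1 * Q) * (D ^ 2 / 4) := by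
      have h1 : ((d 3 : ℝ) - e) * w 3 * Θ * S ≤ ((d 3 : ℝ) - e) * w 3 * Θ * (x * Q) :=
        mul_le_mul_of_nonneg_left hSQ (by positivity)
      have h2 := mul_lt_mul_of_pos_right hxκ hQpos
      have e1 : ((e : ℝ) - d 1) * (w 1 * Q) * (D ^ 2 / 4) = (((e : ℝ) - d 1) * w 1 * D ^ 2 * Q) / 4 := by ring
      have e2 : ((d 3 : ℝ) - e) * w 3 * Θ * (x * Q) = (x * (4 * ((d 3 : ℝ) - e) * w 3 * Θ) * Q) / 4 := by ring
      rw [e1]; rw [e2] at h1; linarith [h1, h2]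
    calc ((d 3 : ℝ) - e) * (w 3 * S) * (τ - t 3) ^ 2 ≤ ((d 3 : ℝ) - e) * w 3 * Θ * S := hpos3
      _ < ((e : ℝ) - d 1) * (w 1 * Q) * (D ^ 2 / 4) := step
      _ ≤ ((e : ℝ) - d 1) * (w 1 * Q) * (τ - t 1) ^ 2 := hneg1
  -- letters 0 and 2 contribute non-positive terms
  have h0np : ((d 0 : ℝ) - e) * (w 0 * P) * (τ - t 0) ^ 2 ≤ 0 := by
    have : (d 0 : ℝ) - e ≤ 0 := sub_nonpos.2 (by exact_mod_cast (by omega : d 0 ≤ e))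
    exact mul_nonpos_of_nonpos_of_nonneg (mul_nonpos_of_nonpos_of_nonneg this (by positivity)) (sq_nonneg _)
  have h2np : ((d 2 : ℝ) - e) * (w 2 * x ^ d 2) * (τ - t 2) ^ 2 ≤ 0 := by
    have : (d 2 : ℝ) - e ≤ 0 := sub_nonpos.2 (by exact_mod_cast h2e)
    exact mul_nonpos_of_nonpos_of_nonneg (mul_nonpos_of_nonpos_of_nonneg this (by positivity)) (sq_nonneg _)
  have e1 : ((d 1 : ℝ) - e) * (w 1 * Q) * (τ - t 1) ^ 2 = -(((e : ℝ) - d 1) * (w 1 * Q) * (τ - t 1) ^ 2) := by ring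
  linarith [hmain, h0np, h2np, e1]

/-! ## 2. Near `∞`: the negative dent of letter `2` wins -/

/-- **SIGNED DENT SUM NEGATIVE NEAR `∞` (`3|1`).**  Four letters with positive weights and positions, exponents `d₀, d₁ ≤ d₂ < e < d₃`,
letters `2, 3` not parallel.  There is `b > 0` such that for every `x ≥ b` and every direction `τ > 0` with `A τ² = C`:
`∑ₖ (dₖ − e)·wₖx^{dₖ}·(τ − tₖ)² < 0` — letter `2`'s negative dent `≥ |t₂−t₃|²/4` at weight `x^{d₂}` beats the top letter's positive dent
`O(x^{2(d₂−d₃)})` at weight `x^{d₃}` (`|T̂ − t₃| ≤ M x^{d₂−d₃}/(w₃t₃)`); letters `0, 1` contribute `≤ 0`. [this file] -/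
theorem signedDent_neg_near_infty (w t : Fin 4 → ℝ) (d : Fin 4 → ℕ) (e : ℕ)
    (hw : ∀ k, 0 < w k) (ht : ∀ k, 0 < t k) (h23 : t 2 ≠ t 3)
    (h02 : d 0 ≤ d 2) (h12 : d 1 ≤ d 2) (h2e : d 2 < e) (he3 : e < d 3) :
    ∃ b, 0 < b ∧ ∀ x, b ≤ x → ∀ τ, 0 < τ →
      (∑ k, w k * x ^ d k) * τ ^ 2 = ∑ k, w k * t k ^ 2 * x ^ d k →
      ∑ k, ((d k : ℝ) - e) * (w k * x ^ d k) * (τ - t k) ^ 2 < 0 := by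
  have hw0 := hw 0; have hw1 := hw 1; have hw2 := hw 2; have hw3 := hw 3
  have ht2 := ht 2; have ht3 := ht 3
  set M : ℝ := w 0 * |t 0 ^ 2 - t 3 ^ 2| + w 1 * |t 1 ^ 2 - t 3 ^ 2| + w 2 * |t 2 ^ 2 - t 3 ^ 2| with hM
  set D : ℝ := |t 3 - t 2| with hD
  have hDpos : 0 < D := abs_pos.2 (sub_ne_zero.2 (Ne.symm h23))
  have hsq23 : t 2 ^ 2 - t 3 ^ 2 ≠ 0 := by
    rw [sq_sub_sq]; exact mul_ne_zero (by linarith) (sub_ne_zero.2 h23)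
  have hMpos : 0 < M := by
    have h2 : 0 < w 2 * |t 2 ^ 2 - t 3 ^ 2| := mul_pos hw2 (abs_pos.2 hsq23)
    have h0 : 0 ≤ w 0 * |t 0 ^ 2 - t 3 ^ 2| := by positivity
    have h1 : 0 ≤ w 1 * |t 1 ^ 2 - t 3 ^ 2| := by positivity
    linarith
  have hed2 : (0 : ℝ) < (e : ℝ) - d 2 := sub_pos.2 (by exact_mod_cast h2e)
  have hd3e : (0 : ℝ) < (d 3 : ℝ) - e := sub_pos.2 (by exact_mod_cast he3)
  set κ : ℝ := 4 * ((d 3 : ℝ) - e) * M ^ 2 / (((e : ℝ) - d 2) * w 2 * D ^ 2 * w 3 * t 3 ^ 2) with hκ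
  set b : ℝ := max 1 (max (2 * M / (D * w 3 * t 3)) (κ + 1)) with hb
  have hb1 : 1 ≤ b := le_max_left _ _
  have hb2 : 2 * M / (D * w 3 * t 3) ≤ b := le_trans (le_max_left _ _) (le_max_right _ _)
  have hb3 : κ + 1 ≤ b := le_trans (le_max_right _ _) (le_max_right _ _)
  refine ⟨b, lt_of_lt_of_le one_pos hb1, ?_⟩
  intro x hbx τ hτ hAC
  have hx1 : 1 ≤ x := hb1.trans hbx
  have hx : 0 < x := lt_of_lt_of_le one_pos hx1
  set R := x ^ d 2 with hR
  set S := x ^ d 3 with hS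
  have hRpos : 0 < R := pow_pos hx _
  have hSpos : 0 < S := pow_pos hx _
  have hR0 : x ^ d 0 ≤ R := pow_le_pow_right₀ hx1 h02
  have hR1 : x ^ d 1 ≤ R := pow_le_pow_right₀ hx1 h12
  have hSR : x * R ≤ S := by
    have h : x ^ (d 2 + 1) ≤ x ^ d 3 := pow_le_pow_right₀ hx1 (by omega)
    rw [pow_succ] at h
    rw [hR, hS]; linarith
  simp only [Fin.sum_univ_four] at hAC ⊢
  rw [← hR, ← hS] at hAC ⊢
  have hA_ge : w 3 * S ≤ w 3 * S + w 0 * x ^ d 0 + w 1 * x ^ d 1 + w 2 * R := by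
    have : 0 ≤ w 0 * x ^ d 0 := by positivity
    have : 0 ≤ w 1 * x ^ d 1 := by positivity
    have : 0 ≤ w 2 * R := by positivity
    linarith
  -- deviation of `τ` from `t₃`: `|τ − t₃|·(w₃ S t₃) ≤ R·M`, hence `|τ − t₃| ≤ D/2`
  have hdevb := dev_bound (w 3 * S) (w 0 * x ^ d 0) (w 1 * x ^ d 1) (w 2 * R) (t 3) (t 0) (t 1) (t 2) τ
    (by positivity) (by positivity) (by positivity) (by positivity) (by linear_combination hAC)
  have hRM : w 0 * x ^ d 0 * |t 0 ^ 2 - t 3 ^ 2| + w 1 * x ^ d 1 * |t 1 ^ 2 - t 3 ^ 2| + w 2 * R * |t 2 ^ 2 - t 3 ^ 2| ≤ R * M := by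
    have a0 : w 0 * x ^ d 0 * |t 0 ^ 2 - t 3 ^ 2| ≤ w 0 * R * |t 0 ^ 2 - t 3 ^ 2| :=
      mul_le_mul_of_nonneg_right (mul_le_mul_of_nonneg_left hR0 hw0.le) (abs_nonneg _)
    have a1 : w 1 * x ^ d 1 * |t 1 ^ 2 - t 3 ^ 2| ≤ w 1 * R * |t 1 ^ 2 - t 3 ^ 2| :=
      mul_le_mul_of_nonneg_right (mul_le_mul_of_nonneg_left hR1 hw1.le) (abs_nonneg _)
    have e : w 0 * R * |t 0 ^ 2 - t 3 ^ 2| + w 1 * R * |t 1 ^ 2 - t 3 ^ 2| + w 2 * R * |t 2 ^ 2 - t 3 ^ 2| = R * M := by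
      rw [hM]; ring
    linarith
  have hkey : |τ - t 3| * (w 3 * S * t 3) ≤ R * M := by
    have h2 : |τ ^ 2 - t 3 ^ 2| * (w 3 * S) ≤ R * M := by
      have := mul_le_mul_of_nonneg_left hA_ge (abs_nonneg (τ ^ 2 - t 3 ^ 2))
      linarith
    calc |τ - t 3| * (w 3 * S * t 3) = (|τ - t 3| * t 3) * (w 3 * S) := by ring
      _ ≤ |τ ^ 2 - t 3 ^ 2| * (w 3 * S) := mul_le_mul_of_nonneg_right (abs_sub_mul_le τ (t 3) hτ ht3) (by positivity)
      _ ≤ R * M := h2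
  have hxb2 : 2 * M ≤ D * w 3 * t 3 * x := by
    have := (div_le_iff₀ (by positivity : (0 : ℝ) < D * w 3 * t 3)).1 (hb2.trans hbx)
    linarith
  have hdev3 : |τ - t 3| ≤ |t 3 - t 2| / 2 := by
    have h : |τ - t 3| * (w 3 * S * t 3) ≤ (D / 2) * (w 3 * S * t 3) := by
      calc |τ - t 3| * (w 3 * S * t 3) ≤ R * M := hkey
        _ = (2 * M) * R / 2 := by ring
        _ ≤ (D * w 3 * t 3 * x) * R / 2 := by
            have := mul_le_mul_of_nonneg_right hxb2 hRpos.le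
            linarith
        _ = (D / 2) * (w 3 * t 3) * (x * R) := by ring
        _ ≤ (D / 2) * (w 3 * t 3) * S := mul_le_mul_of_nonneg_left hSR (by positivity)
        _ = (D / 2) * (w 3 * S * t 3) := by ring
    exact le_of_mul_le_mul_right h (by positivity)
  have hdent2 : D ^ 2 / 4 ≤ (τ - t 2) ^ 2 := by
    have h := quarter_sq_le τ (t 3) (t 2) hdev3
    rwa [← sq_abs (t 3 - t 2), ← hD] at h
  -- the positive term of letter 3 against `(R M)²`, the negative term of letter 2, the threshold `x > κ`
  have hpos : ((d 3 : ℝ) - e) * (w 3 * S) * (τ - t 3) ^ 2 * (w 3 * S * t 3 ^ 2) ≤ ((d 3 : ℝ) - e) * (R * M) ^ 2 := by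
    have hsq : (|τ - t 3| * (w 3 * S * t 3)) ^ 2 ≤ (R * M) ^ 2 := pow_le_pow_left₀ (by positivity) hkey 2
    have e1 : ((d 3 : ℝ) - e) * (w 3 * S) * (τ - t 3) ^ 2 * (w 3 * S * t 3 ^ 2)
        = ((d 3 : ℝ) - e) * (|τ - t 3| * (w 3 * S * t 3)) ^ 2 := by rw [mul_pow, sq_abs]; ring
    rw [e1]
    exact mul_le_mul_of_nonneg_left hsq hd3e.le
  have hneg2 : ((e : ℝ) - d 2) * (w 2 * R) * (D ^ 2 / 4) ≤ ((e : ℝ) - d 2) * (w 2 * R) * (τ - t 2) ^ 2 :=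
    mul_le_mul_of_nonneg_left hdent2 (by positivity)
  have hxκ : 4 * ((d 3 : ℝ) - e) * M ^ 2 < x * (((e : ℝ) - d 2) * w 2 * D ^ 2 * w 3 * t 3 ^ 2) := by
    have hlt : κ < x := by linarith [hb3.trans hbx]
    rw [hκ, div_lt_iff₀ (by positivity)] at hlt
    exact hlt
  have hmain : ((d 3 : ℝ) - e) * (w 3 * S) * (τ - t 3) ^ 2 < ((e : ℝ) - d 2) * (w 2 * R) * (τ - t 2) ^ 2 := by
    have hc : 0 < w 3 * S * t 3 ^ 2 := by positivity
    have h1 : ((d 3 : ℝ) - e) * (R * M) ^ 2 < ((e : ℝ) - d 2) * (w 2 * R) * (D ^ 2 / 4) * (w 3 * (x * R) * t 3 ^ 2) := by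
      have h := mul_lt_mul_of_pos_right hxκ (mul_pos hRpos hRpos)
      have e1 : 4 * ((d 3 : ℝ) - e) * M ^ 2 * (R * R) = 4 * (((d 3 : ℝ) - e) * (R * M) ^ 2) := by ring
      have e2 : x * (((e : ℝ) - d 2) * w 2 * D ^ 2 * w 3 * t 3 ^ 2) * (R * R)
          = 4 * (((e : ℝ) - d 2) * (w 2 * R) * (D ^ 2 / 4) * (w 3 * (x * R) * t 3 ^ 2)) := by ring
      rw [e1, e2] at h
      linarith
    have h2 : ((e : ℝ) - d 2) * (w 2 * R) * (D ^ 2 / 4) * (w 3 * (x * R) * t 3 ^ 2)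
        ≤ ((e : ℝ) - d 2) * (w 2 * R) * (D ^ 2 / 4) * (w 3 * S * t 3 ^ 2) := by
      have := mul_le_mul_of_nonneg_left hSR (by positivity : (0 : ℝ) ≤ ((e : ℝ) - d 2) * (w 2 * R) * (D ^ 2 / 4) * w 3 * t 3 ^ 2)
      linarith [this]
    have h3 := lt_of_le_of_lt hpos (lt_of_lt_of_le h1 h2)
    have h4 := mul_le_mul_of_nonneg_right hneg2 hc.le
    exact lt_of_mul_lt_mul_right (lt_of_lt_of_le h3 h4) hc.le
  -- letters 0 and 1 contribute non-positive terms
  have h0np : ((d 0 : ℝ) - e) * (w 0 * x ^ d 0) * (τ - t 0) ^ 2 ≤ 0 := by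
    have : (d 0 : ℝ) - e ≤ 0 := sub_nonpos.2 (by exact_mod_cast (by omega : d 0 ≤ e))
    exact mul_nonpos_of_nonpos_of_nonneg (mul_nonpos_of_nonpos_of_nonneg this (by positivity)) (sq_nonneg _)
  have h1np : ((d 1 : ℝ) - e) * (w 1 * x ^ d 1) * (τ - t 1) ^ 2 ≤ 0 := by
    have : (d 1 : ℝ) - e ≤ 0 := sub_nonpos.2 (by exact_mod_cast (by omega : d 1 ≤ e))
    exact mul_nonpos_of_nonpos_of_nonneg (mul_nonpos_of_nonpos_of_nonneg this (by positivity)) (sq_nonneg _)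
  have e2 : ((d 2 : ℝ) - e) * (w 2 * R) * (τ - t 2) ^ 2 = -(((e : ℝ) - d 2) * (w 2 * R) * (τ - t 2) ^ 2) := by ring
  linarith [hmain, h0np, h1np, e2]

/-! ## 3. End values of the profile `E` on the `3|1` split -/

/-- **`E < e` NEAR `0⁺` ON THE `3|1` SPLIT** (`d₀ < d₁ ≤ d₂ ≤ e < d₃`, `d₁ < e`; letters `0, 1` not parallel).  (Located value: `E(0⁺) = d₁`.)
[this file] -/
theorem profile_lt_near_zero (w t : Fin 4 → ℝ) (d : Fin 4 → ℕ) (e : ℕ)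
    (hw : ∀ k, 0 < w k) (ht : ∀ k, 0 < t k) (h01 : t 0 ≠ t 1)
    (h01d : d 0 < d 1) (h12 : d 1 ≤ d 2) (h2e : d 2 ≤ e) (h1e : d 1 < e) (he3 : e < d 3) :
    ∃ a, 0 < a ∧ ∀ x, 0 < x → x ≤ a →
      (∑ k, (d k : ℝ) * (w k * x ^ d k)
          * (Real.sqrt ((∑ l, w l * t l ^ 2 * x ^ d l) / (∑ l, w l * x ^ d l)) - t k) ^ 2)
        / (∑ k, w k * x ^ d k
          * (Real.sqrt ((∑ l, w l * t l ^ 2 * x ^ d l) / (∑ l, w l * x ^ d l)) - t k) ^ 2) < (e : ℝ) := by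
  obtain ⟨a, ha, h⟩ := signedDent_neg_near_zero w t d e hw ht h01 h01d h12 h2e h1e he3
  refine ⟨a, ha, fun x hx hxa => ?_⟩
  set τ := Real.sqrt ((∑ l, w l * t l ^ 2 * x ^ d l) / (∑ l, w l * x ^ d l)) with hτ
  obtain ⟨hτpos, hτC⟩ := optDir_pos_sq (Finset.univ : Finset (Fin 4)) ⟨0, Finset.mem_univ _⟩ w t d
    (fun m _ => hw m) (fun m _ => ht m) hx
  have hZ := dent_pos (Finset.univ : Finset (Fin 4)) w t d (fun m _ => hw m) (Finset.mem_univ 0) (Finset.mem_univ 1)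
    h01 hx τ
  have hN := h x hx hxa τ hτpos hτC
  rw [div_lt_iff₀ hZ]
  have := profile_num_sub w t d e x τ
  linarith

/-- **`E < e` NEAR `∞` ON THE `3|1` SPLIT** (`d₀, d₁ ≤ d₂ < e < d₃`; letters `2, 3` not parallel, `0, 1` not parallel so that `E` is defined).
(Located value: `E(∞) = d₂`.) [this file] -/
theorem profile_lt_near_infty (w t : Fin 4 → ℝ) (d : Fin 4 → ℕ) (e : ℕ)
    (hw : ∀ k, 0 < w k) (ht : ∀ k, 0 < t k) (h01 : t 0 ≠ t 1) (h23 : t 2 ≠ t 3)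
    (h02 : d 0 ≤ d 2) (h12 : d 1 ≤ d 2) (h2e : d 2 < e) (he3 : e < d 3) :
    ∃ b, 0 < b ∧ ∀ x, b ≤ x →
      (∑ k, (d k : ℝ) * (w k * x ^ d k)
          * (Real.sqrt ((∑ l, w l * t l ^ 2 * x ^ d l) / (∑ l, w l * x ^ d l)) - t k) ^ 2)
        / (∑ k, w k * x ^ d k
          * (Real.sqrt ((∑ l, w l * t l ^ 2 * x ^ d l) / (∑ l, w l * x ^ d l)) - t k) ^ 2) < (e : ℝ) := by
  obtain ⟨b, hb, h⟩ := signedDent_neg_near_infty w t d e hw ht h23 h02 h12 h2e he3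
  refine ⟨b, hb, fun x hbx => ?_⟩
  have hx : 0 < x := lt_of_lt_of_le hb hbx
  set τ := Real.sqrt ((∑ l, w l * t l ^ 2 * x ^ d l) / (∑ l, w l * x ^ d l)) with hτ
  obtain ⟨hτpos, hτC⟩ := optDir_pos_sq (Finset.univ : Finset (Fin 4)) ⟨0, Finset.mem_univ _⟩ w t d
    (fun m _ => hw m) (fun m _ => ht m) hx
  have hZ := dent_pos (Finset.univ : Finset (Fin 4)) w t d (fun m _ => hw m) (Finset.mem_univ 0) (Finset.mem_univ 1)
    h01 hx τ
  have hN := h x hbx τ hτpos hτC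
  rw [div_lt_iff₀ hZ]
  have := profile_num_sub w t d e x τ
  linarith

end Summit.ValiantsHypothesis.ValiantsHypothesis.Theorems.LacunarySymmetroidMatrixDescartes.Pivot.CriticalWindows.TurningEndsMirror
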